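import Literature.NumberTheory.LFunctions.RHConditionalFacts
import Literature.Analysis.Complex.DeBruijnUniversalFactors
import Mathlib.Algebra.QuadraticDiscriminant
import Mathlib.Analysis.SpecialFunctions.ExpDeriv
import Mathlib.Analysis.Calculus.IteratedDeriv.Lemmas
import Mathlib.Analysis.Complex.Exponential
import HarnessLib

/-!
# Barrier: large-shift hyperbolicity of Jensen polynomials carries no information on RH (Farmer 2022)

Barrier catalogue `Literature/Barriers/RiemannHypothesis/` (D-0021), entry `JensenPolynomials`
(namespace `Literature.Barriers.RiemannHypothesis`; the catalogued declaration is `JensenPolynomials`,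
PROVED here as `JensenPolynomials_holds`).

## The technique (Jensen 1913, Pólya 1927; Griffin–Ono–Rolen–Zagier 2019)

With `(−1 + 4z²) Λ(1/2 + z) = ∑ γ(n) z^{2n}/n!` (the tree's `Literature.NumberTheory.LFunctions.xiTaylorCoeff`) and the Jensen
polynomials `J^{d,n}_α(X) = ∑_{j ≤ d} (d choose j) α(n + j) X^j` (the tree's `Literature.NumberTheory.LFunctions.jensenPoly`):
"the RH is equivalent to the hyperbolicity of the polynomials `J^{d,n}_γ(X)` for all non-negative
integers `d` and `n`" (GORZ 2019, §1; the tree's `Literature.RH.polya_jensen : RH ↔ JensenPolyaCriterion`).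
GORZ 2019, **Theorem 1**: "If `d ≥ 1`, then `J^{d,n}_γ(X)` is hyperbolic for all sufficiently large `n`"
(the tree's `Literature.NumberTheory.LFunctions.gorz_eventually`), a special case of their **Theorem 3** / Corollary: the Jensen
polynomials of *any* sequence with suitable growth ("Hermite universality") "are hyperbolic for all
but finitely many values `n`" (vendored below as `GORZ2019_thm3_corollary`).

## The obstruction (Farmer 2022, §§2, 4; what this file vendors)

For the classical Jensen polynomials `J^{d,n}_{f,cl}(z) = ∑_{j ≤ d} (d choose j) α(j+n) z^j` of an
entire `f(z) = ∑ α(j) z^j/j!` of order `< 2` (so `α(j) = f^{(j)}(0)`; `J^{d,n}_{f,cl}` is the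
`d`-th Jensen polynomial of `f^{(n)}`):
* (Kim's theorem, as printed in §2) "if `f` is an entire function of order less than 2, which is real
  on the real axis, and which has all zeros in a strip `|Im(z)| < A`, then for any fixed `R > 0`, if
  `n` is sufficiently large then `f^{(n)}` has only real zeros in `|z| < R`. … A corollary is that for
  any `d`, if `n` is large enough then the classical Jensen polynomial `J^{d,n}_{f,cl}` has only real
  zeros." — vendored as the named facts `Farmer2022_kimTheorem`, `Farmer2022_kimCorollary`.
* "We see that the classical Jensen polynomials `J^{d,n}_{f,cl}` having real zeros for large `n` is a
  general phenomenon, following from the fact that, for a large class of entire functions, repeated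
  differentiation leads to the cosine function. In particular, differentiation causes a loss of
  information about the zeros of the functions considered here, and so in terms of the Riemann
  Hypothesis there is little revealed by the derivatives of the function." (§2) "We have seen that the
  Jensen polynomials of derivatives, `J^{d,n}` for `n ≥ 1`, do not shed any light on the Riemann
  Hypothesis, because each increase in the differentiation index loses information about the location
  of the zeros." (§4) Farmer's printed witness is `X_{10}(z) = cos z · (moved zeros)`, for which "all
  zeros of the first derivative, `X'_{10}`, are real [read off a graph], therefore … `J^{d,n}_{X_{10},cl}`
  has only real zeros for all `n ≥ 1`", while `J^{d,0}_{X_{10},cl}` is hyperbolic exactly for `d ≤ 118`.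
* For shift `0`: "Chasse proved that if all the zeros … are on the critical line for `|γ| < T`, then
  `J^{d,0}` has only real zeros for `d < T²`" and the Jensen polynomials "are not efficient at
  extracting information from those coefficients" (§4); "hyperbolicity for `J^{d,0}_γ(X)` has been
  confirmed for `d ≤ 2·10^17` by Chasse" (GORZ 2019, §1, footnote) — vendored as `GORZ2019_chasse`.

**The barrier, PROVED (`JensenPolynomials_holds`).** There is a real entire function of order `< 2`
with all its zeros in a horizontal strip but NOT all real — the elementary witness
`quadExp z = (1 + z²) eᶻ` (zeros `± i`), used here in place of Farmer's `X_{10}` — whose classical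
Jensen polynomials `J^{d,n}_{f,cl}` are hyperbolic for every degree `d` and EVERY shift `n ≥ 1`
(so the conclusion of Kim's corollary / the shape of GORZ Thm. 1 holds for it, uniformly with
`N(d) = 1`), while `J^{d,0}_{f,cl}` is non-hyperbolic for every `d ≥ 2`. Hence no inference from
"for each `d`, `J^{d,n}` is hyperbolic for all large `n`" to "all `J^{d,n}` are hyperbolic" (for `γ`:
to RH, by Pólya) can be valid on the class of functions covered by the printed mechanism. The proof is
an explicit factorisation `J^{d+2,n} = (X + 1)^d · Q_{d+2,n}` with a real quadratic `Q` whose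
discriminant `4(d+2)((n−1)(n+d+2)+1)` is `≥ 0` iff `n ≥ 1`.

## References

* [Farmer2022] D. W. Farmer, *Jensen polynomials are not a plausible route to proving the Riemann
  hypothesis*, Adv. Math. 411 (2022), 108781; arXiv:2008.07206 (read: §§1–5; title of the arXiv
  version: "… not a viable route …").
* [GORZPNAS2019] M. Griffin, K. Ono, L. Rolen, D. Zagier, *Jensen polynomials for the Riemann zeta
  function and other sequences*, PNAS 116 (2019), 11103–11110; arXiv:1902.07321 (read: §1, Thms. 1–3
  and Corollary).
* [Kim1996] Y.-O. Kim, *Critical points of real entire functions and a conjecture of Pólya*, Proc.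
  AMS 124 (1996), 819–829 (Farmer's [Kim]; cited through [Farmer2022, §2]).
* [Chasse2013] M. Chasse, *Laguerre multiplier sequences and sector properties of entire functions*,
  Complex Var. Elliptic Equ. 58 (2013), 875–885 (cited through [GORZPNAS2019, §1] and
  [Farmer2022, §4]; not read).
* [Polya1927] G. Pólya, Kgl. Danske Vid. Sel. Math.-Fys. Medd. 7 (1927) — the tree's
  `Literature.NumberTheory.LFunctions.polya_jensen`.

## Design notes

* Hyperbolic = `Polynomial.Splits` over `ℝ`, as in the tree's `Literature.NumberTheory.LFunctions.JensenPolyaCriterion`; the zero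
  polynomial splits, which is harmless here (`quadExp` Jensen polynomials are non-zero, and
  non-hyperbolicity is proved outright).
* `taylorCoeffSeq f j = Re f^{(j)}(0)`: for `f` entire, `f(z) = ∑ f^{(j)}(0) z^j/j!`, so this is
  Farmer's `α(j)` (real for `f` real on `ℝ`); `classicalJensenPoly f d n = Literature.jensenPoly (taylorCoeffSeq f) d n`
  is Farmer's `J^{d,n}_{f,cl}` (his index `α(j + n)` = the tree's `γ(n + j)`).
* "Order `< 2`" is the tree's `Literature.IsEntireOfOrderLt 2` (`∃ ρ < 2, ∃ C, ∀ z, ‖f z‖ ≤ C exp(‖z‖^ρ)`),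
  and the strip condition is `∃ Δ, Literature.RootsInStrip f Δ` (`|Im z| ≤ Δ`; with the existential this is
  Farmer's `|Im z| < A`).
-/

noncomputable section

open Complex Polynomial Filter Topology Asymptotics
open scoped Nat

namespace Literature.Barriers.RiemannHypothesis

/-! ## Vocabulary: classical Jensen polynomials of an entire function (Farmer 2022, §2) -/

/-- Taylor coefficients in Farmer's normalisation: for `f` entire, `f(z) = ∑ α(j) z^j / j!` with
`α(j) = f^{(j)}(0)`; we take the real part (for `f` real on the real axis the value is real).
[cite: Farmer2022, §2 eq. (2.1)] -/
def taylorCoeffSeq (f : ℂ → ℂ) (j : ℕ) : ℝ :=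
  (iteratedDeriv j f 0).re

/-- The classical Jensen polynomial `J^{d,n}_{f,cl}(z) = ∑_{j=0}^{d} (d choose j) α(j + n) z^j` of
degree `d` for the `n`-th derivative of `f` (Farmer 2022, (2.2)); it is the tree's
`Literature.jensenPoly (taylorCoeffSeq f) d n`. [cite: Farmer2022, §2 eq. (2.2)] -/
abbrev classicalJensenPoly (f : ℂ → ℂ) (d n : ℕ) : ℝ[X] :=
  Literature.NumberTheory.LFunctions.jensenPoly (taylorCoeffSeq f) d n

/-- Farmer's standing hypotheses (§2, after Kim): `f` entire of order less than `2`, real on the real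
axis, with all zeros in some strip `|Im z| < A` — assembled from the tree's de Bruijn vocabulary
`Literature.IsEntireOfOrderLt 2`, `Literature.Analysis.Complex.IsRealOnReal`, `Literature.Analysis.Complex.RootsInStrip` (the class of de Bruijn 1950,
Thm. 6, `Literature.Analysis.Complex.DeBruijn1950.thm6`). [cite: Farmer2022, §2] -/
def IsRealEntireOrderLtTwoStrip (f : ℂ → ℂ) : Prop :=
  Literature.Analysis.Complex.IsEntireOfOrderLt 2 f ∧ Literature.Analysis.Complex.IsRealOnReal f ∧ ∃ Δ : ℝ, Literature.Analysis.Complex.RootsInStrip f Δ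

/-- **Large-shift hyperbolicity** of the Jensen polynomials of a real sequence `a` — the conclusion
shape of GORZ 2019 Thm. 1 and of Kim's corollary: for every degree `d ≥ 1`, `J^{d,n}_a` is hyperbolic
for all sufficiently large shifts `n`. [cite: GORZPNAS2019, Theorem 1] -/
def EventuallyHyperbolic (a : ℕ → ℝ) : Prop :=
  ∀ d : ℕ, 1 ≤ d → ∃ N : ℕ, ∀ n : ℕ, N ≤ n → (Literature.NumberTheory.LFunctions.jensenPoly a d n).Splits

/-- **Full hyperbolicity**: every `J^{d,n}_a`, `d, n ≥ 0`, is hyperbolic — for `a = γ` this is the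
tree's `Literature.NumberTheory.LFunctions.JensenPolyaCriterion`, equivalent to RH (Pólya 1927, `Literature.NumberTheory.LFunctions.polya_jensen`).
[cite: GORZPNAS2019, §1] -/
def AllHyperbolic (a : ℕ → ℝ) : Prop :=
  ∀ d n : ℕ, (Literature.NumberTheory.LFunctions.jensenPoly a d n).Splits

/-- `Literature.NumberTheory.LFunctions.gorz_eventually` is `EventuallyHyperbolic xiTaylorCoeff`. [cite: GORZPNAS2019, Theorem 1] -/
theorem gorz_eventually_iff : Literature.NumberTheory.LFunctions.gorz_eventually ↔ EventuallyHyperbolic Literature.NumberTheory.LFunctions.xiTaylorCoeff :=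
  Iff.rfl

/-- `Literature.NumberTheory.LFunctions.JensenPolyaCriterion` is `AllHyperbolic xiTaylorCoeff`. [cite: GORZPNAS2019, §1] -/
theorem jensenPolyaCriterion_iff : Literature.NumberTheory.LFunctions.JensenPolyaCriterion ↔ AllHyperbolic Literature.NumberTheory.LFunctions.xiTaylorCoeff :=
  Iff.rfl

/-- The route's last step is Pólya's criterion: full hyperbolicity for `γ` gives RH (from the tree's
named fact `Literature.NumberTheory.LFunctions.polya_jensen`). [cite: GORZPNAS2019, §1] -/
theorem riemannHypothesis_of_allHyperbolic (hP : Literature.NumberTheory.LFunctions.polya_jensen)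
    (h : AllHyperbolic Literature.NumberTheory.LFunctions.xiTaylorCoeff) : RiemannHypothesis :=
  hP.2 h

/-! ## Named facts (as printed) -/

/-- **Kim's theorem, as printed in Farmer 2022, §2.** "if `f` is an entire function of order less
than 2, which is real on the real axis, and which has all zeros in a strip `|Im(z)| < A`, then for any
fixed `R > 0`, if `n` is sufficiently large then `f^{(n)}` has only real zeros in `|z| < R`." The
printed sentence tacitly excludes derivatives vanishing identically (for a polynomial `f`,
`f^{(n)} ≡ 0` for large `n` and "only real zeros" fails trivially); we add the hypothesis that no
derivative of `f` is identically zero (i.e. `f` is not a polynomial).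
[cite: Farmer2022, §2] [cite: Kim1996] -/
def Farmer2022_kimTheorem : Prop :=
  ∀ f : ℂ → ℂ, IsRealEntireOrderLtTwoStrip f → (∀ n : ℕ, iteratedDeriv n f ≠ 0) → ∀ R : ℝ, 0 < R →
    ∃ N : ℕ, ∀ n : ℕ, N ≤ n → ∀ z : ℂ, ‖z‖ < R → iteratedDeriv n f z = 0 → z.im = 0

/-- **Kim's corollary, as printed in Farmer 2022, §2.** "A corollary is that for any `d`, if `n` is
large enough then the classical Jensen polynomial `J^{d,n}_{f,cl}` has only real zeros" (for `f` as in
Kim's theorem). [cite: Farmer2022, §2] [cite: Kim1996] -/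
def Farmer2022_kimCorollary : Prop :=
  ∀ f : ℂ → ℂ, IsRealEntireOrderLtTwoStrip f →
    ∀ d : ℕ, ∃ N : ℕ, ∀ n : ℕ, N ≤ n → (classicalJensenPoly f d n).Splits

/-- **GORZ 2019, Theorem 3 with its Corollary (Hermite universality ⟹ hyperbolicity).** "Let
`{α(n)}`, `{A(n)}` and `{δ(n)}` be three sequences of positive real numbers with `δ(n)` tending to zero
and satisfying `log(α(n+j)/α(n)) = A(n) j − δ(n)² j² + o(δ(n)^d)` as `n → ∞` for some integer `d ≥ 1`
and all `0 ≤ j ≤ d`. Then [the rescaled `J^{d,n}_α` converge to the Hermite polynomial `H_d`] …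
Corollary. The Jensen polynomials `J^{d,n}_α(X)` … are hyperbolic for all but finitely many values
`n`." Vendored: the corollary. [cite: GORZPNAS2019, Theorem 3 and Corollary] -/
def GORZ2019_thm3_corollary : Prop :=
  ∀ (α A δ : ℕ → ℝ) (d : ℕ), 1 ≤ d →
    (∀ n, 0 < α n) → (∀ n, 0 < A n) → (∀ n, 0 < δ n) → Tendsto δ atTop (𝓝 0) →
    (∀ j : ℕ, j ≤ d →
      (fun n : ℕ ↦ Real.log (α (n + j) / α n) - A n * j + δ n ^ 2 * (j : ℝ) ^ 2) =o[atTop]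
        fun n : ℕ ↦ δ n ^ d) →
    ∃ N : ℕ, ∀ n : ℕ, N ≤ n → (Literature.NumberTheory.LFunctions.jensenPoly α d n).Splits

/-- **Chasse's verification, as printed in GORZ 2019, §1 (footnote):** "The hyperbolicity for
`J^{d,0}_γ(X)` has been confirmed for `d ≤ 2·10^17` by Chasse (cf. Theorem 1.8 of [Chasse])"; Farmer
2022, §4: "Chasse proved that if all the zeros `ρ = β + iγ` of the zeta-function are on the critical
line for `|γ| < T`, then `J^{d,0}` has only real zeros for `d < T²`"; the Jensen polynomials "are
not efficient at extracting information from those [Taylor] coefficients".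
[cite: GORZPNAS2019, §1] [cite: Chasse2013, Theorem 1.8] [cite: Farmer2022, §4] -/
def GORZ2019_chasse : Prop :=
  ∀ d : ℕ, d ≤ 2 * 10 ^ 17 → (Literature.NumberTheory.LFunctions.jensenPoly Literature.NumberTheory.LFunctions.xiTaylorCoeff d 0).Splits

/-! ## Jensen polynomials: coefficients and the shift recursion -/

/-- Coefficients of `J^{d,n}_a`: `[X^k] J^{d,n}_a = (d choose k) a(n + k)` (zero for `k > d`).
[cite: GORZPNAS2019, §1] -/
theorem coeff_jensenPoly (a : ℕ → ℝ) (d n k : ℕ) :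
    (Literature.NumberTheory.LFunctions.jensenPoly a d n).coeff k = (d.choose k : ℝ) * a (n + k) := by
  rw [Literature.NumberTheory.LFunctions.jensenPoly, finsetSum_coeff]
  simp only [coeff_C_mul_X_pow]
  rw [Finset.sum_ite_eq]
  split_ifs with h
  · rfl
  · rw [Finset.mem_range, not_lt] at h
    rw [Nat.choose_eq_zero_of_lt (by omega)]
    simp

/-- `J^{d,n}_a` has degree at most `d`. [cite: GORZPNAS2019, §1] -/
theorem natDegree_jensenPoly_le (a : ℕ → ℝ) (d n : ℕ) : (Literature.NumberTheory.LFunctions.jensenPoly a d n).natDegree ≤ d := by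
  apply natDegree_sum_le_of_forall_le
  intro j hj
  refine (natDegree_C_mul_X_pow_le _ _).trans ?_
  simpa [Nat.lt_succ_iff] using hj

/-- The shift recursion `J^{d+1,n}_a = J^{d,n}_a + X · J^{d,n+1}_a` (Pascal's rule). [folklore] -/
theorem jensenPoly_succ (a : ℕ → ℝ) (d n : ℕ) :
    Literature.NumberTheory.LFunctions.jensenPoly a (d + 1) n = Literature.NumberTheory.LFunctions.jensenPoly a d n + X * Literature.NumberTheory.LFunctions.jensenPoly a d (n + 1) := by
  ext k
  rw [coeff_add, coeff_jensenPoly, coeff_jensenPoly]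
  cases k with
  | zero => simp
  | succ k =>
    rw [coeff_X_mul, coeff_jensenPoly, Nat.choose_succ_succ', Nat.cast_add,
      show n + 1 + k = n + (k + 1) by ring]
    ring

/-! ## The witness `quadExp z = (1 + z²) eᶻ` -/

/-- The witness function `f(z) = (1 + z²) eᶻ`: real entire of order `1`, zeros exactly `± i`. (An
elementary stand-in for Farmer's `X_{10}`.) [folklore] -/
def quadExp (z : ℂ) : ℂ :=
  (1 + z ^ 2) * Complex.exp z

/-- Its Taylor coefficient sequence `α(m) = f^{(m)}(0) = m(m − 1) + 1` (`1, 1, 3, 7, 13, …`). [folklore] -/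
def quadExpCoeff (m : ℕ) : ℝ :=
  (m : ℝ) * ((m : ℝ) - 1) + 1

/-- `α(m) = m(m−1) + 1 > 0`. [folklore] -/
theorem quadExpCoeff_pos (m : ℕ) : 0 < quadExpCoeff m := by
  unfold quadExpCoeff
  rcases Nat.eq_zero_or_pos m with rfl | hm
  · simp
  · have : (1 : ℝ) ≤ m := by exact_mod_cast hm
    nlinarith

/-- Derivative of `(w² + b w + c) e^w`. [folklore] -/
theorem hasDerivAt_quadMulExp (b c z : ℂ) :
    HasDerivAt (fun w : ℂ ↦ (w ^ 2 + b * w + c) * Complex.exp w)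
      ((z ^ 2 + (b + 2) * z + (b + c)) * Complex.exp z) z := by
  have h0 : HasDerivAt (fun w : ℂ ↦ w ^ 2) (2 * z) z := by
    simpa using hasDerivAt_pow 2 z
  have h1 : HasDerivAt (fun w : ℂ ↦ w ^ 2 + b * w + c) (2 * z + b * 1) z :=
    (h0.add ((hasDerivAt_id' z).const_mul b)).add_const c
  exact (h1.mul (Complex.hasDerivAt_exp z)).congr_deriv (by ring)

/-- `f^{(m)}(z) = (z² + 2m z + m(m−1) + 1) eᶻ`. [folklore] -/
theorem iteratedDeriv_quadExp (m : ℕ) :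
    iteratedDeriv m quadExp =
      fun z ↦ (z ^ 2 + 2 * (m : ℂ) * z + ((m : ℂ) * ((m : ℂ) - 1) + 1)) * Complex.exp z := by
  induction m with
  | zero =>
    funext z
    rw [iteratedDeriv_zero, quadExp]
    push_cast
    ring
  | succ m ih =>
    rw [iteratedDeriv_succ, ih]
    funext z
    rw [(hasDerivAt_quadMulExp (2 * (m : ℂ)) ((m : ℂ) * ((m : ℂ) - 1) + 1) z).deriv]
    push_cast
    ring

/-- `f^{(m)}(0) = m(m−1) + 1 = α(m)`. [folklore] -/
theorem iteratedDeriv_quadExp_zero (m : ℕ) :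
    iteratedDeriv m quadExp 0 = ((quadExpCoeff m : ℝ) : ℂ) := by
  rw [iteratedDeriv_quadExp]
  simp [quadExpCoeff]

/-- No derivative of `quadExp` vanishes identically (it is not a polynomial), so the guarded
`Farmer2022_kimTheorem` applies to it. [folklore] -/
theorem iteratedDeriv_quadExp_ne_zero (m : ℕ) : iteratedDeriv m quadExp ≠ 0 := by
  intro h
  have := congrFun h 0
  rw [iteratedDeriv_quadExp_zero, Pi.zero_apply, ofReal_eq_zero] at this
  exact (quadExpCoeff_pos m).ne' this

/-- The Taylor coefficients of `quadExp` are the `quadExpCoeff m` (and are real). [folklore] -/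
theorem taylorCoeffSeq_quadExp : taylorCoeffSeq quadExp = quadExpCoeff := by
  funext m
  rw [taylorCoeffSeq, iteratedDeriv_quadExp_zero, ofReal_re]

/-- The Taylor coefficients `f^{(m)}(0)` of `quadExp` are real. [folklore] -/
theorem im_iteratedDeriv_quadExp_zero (m : ℕ) : (iteratedDeriv m quadExp 0).im = 0 := by
  rw [iteratedDeriv_quadExp_zero, ofReal_im]

/-- `quadExp` is entire. [folklore] -/
theorem differentiable_quadExp : Differentiable ℂ quadExp :=
  ((differentiable_const _).add (differentiable_pow 2)).mul Complex.differentiable_exp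

/-- `quadExp` is real on the real axis. [folklore] -/
theorem im_quadExp_ofReal (x : ℝ) : (quadExp x).im = 0 := by
  have : quadExp x = (((1 + x ^ 2) * Real.exp x : ℝ) : ℂ) := by
    simp [quadExp, Complex.ofReal_exp]
  rw [this, ofReal_im]

/-- The zeros of `quadExp` are exactly `± i`. [folklore] -/
theorem quadExp_eq_zero_iff (z : ℂ) : quadExp z = 0 ↔ z = I ∨ z = -I := by
  have hfac : 1 + z ^ 2 = (z - I) * (z + I) := by
    ring_nf
    rw [I_sq]
    ring
  rw [quadExp, mul_eq_zero, or_iff_left (Complex.exp_ne_zero z), hfac, mul_eq_zero, sub_eq_zero,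
    add_eq_zero_iff_eq_neg]

/-- Growth: `‖quadExp z‖ ≤ 2 e^{2‖z‖}` (exponential type, order `≤ 1 < 2`). [folklore] -/
theorem norm_quadExp_le (z : ℂ) : ‖quadExp z‖ ≤ 2 * Real.exp (2 * ‖z‖ ^ (1 : ℝ)) := by
  rw [Real.rpow_one, quadExp, norm_mul, Complex.norm_exp]
  have h1 : ‖1 + z ^ 2‖ ≤ 2 * Real.exp ‖z‖ := by
    have hq := Real.quadratic_le_exp_of_nonneg (norm_nonneg z)
    calc ‖1 + z ^ 2‖ ≤ ‖(1 : ℂ)‖ + ‖z ^ 2‖ := norm_add_le _ _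
      _ = 1 + ‖z‖ ^ 2 := by simp [norm_pow]
      _ ≤ 2 * Real.exp ‖z‖ := by nlinarith [norm_nonneg z]
  have h2 : Real.exp z.re ≤ Real.exp ‖z‖ := Real.exp_le_exp.2 (re_le_norm z)
  calc ‖1 + z ^ 2‖ * Real.exp z.re ≤ (2 * Real.exp ‖z‖) * Real.exp ‖z‖ := by
        gcongr
    _ = 2 * Real.exp (2 * ‖z‖) := by rw [mul_assoc, ← Real.exp_add]; ring_nf

/-- `2r ≤ r^{3/2} + 8` for `r ≥ 0` (so that `e^{2r} ≤ e^8 e^{r^{3/2}}`). [folklore] -/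
theorem two_mul_le_rpow_three_halves_add {r : ℝ} (hr : 0 ≤ r) : 2 * r ≤ r ^ (3 / 2 : ℝ) + 8 := by
  rcases le_or_gt r 4 with h4 | h4
  · linarith [Real.rpow_nonneg hr (3 / 2 : ℝ)]
  · have hr0 : 0 < r := by linarith
    have hsplit : r ^ (3 / 2 : ℝ) = r * Real.sqrt r := by
      rw [show (3 / 2 : ℝ) = 1 + 1 / 2 by norm_num, Real.rpow_add hr0, Real.rpow_one,
        Real.sqrt_eq_rpow]
    have hsqrt : 2 ≤ Real.sqrt r := by
      rw [show (2 : ℝ) = Real.sqrt 4 by rw [show (4 : ℝ) = 2 ^ 2 by norm_num, Real.sqrt_sq (by norm_num)]]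
      exact Real.sqrt_le_sqrt h4.le
    rw [hsplit]
    nlinarith

/-- `quadExp` has order `< 2` in the tree's sense (`ρ = 3/2`, `C = 2e⁸`). [folklore] -/
theorem isEntireOfOrderLt_two_quadExp : Literature.Analysis.Complex.IsEntireOfOrderLt 2 quadExp := by
  refine ⟨differentiable_quadExp, 3 / 2, 2 * Real.exp 8, by norm_num, fun z ↦ ?_⟩
  have h1 := norm_quadExp_le z
  rw [Real.rpow_one] at h1
  have h2 : Real.exp (2 * ‖z‖) ≤ Real.exp 8 * Real.exp (‖z‖ ^ (3 / 2 : ℝ)) := by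
    rw [← Real.exp_add, Real.exp_le_exp]
    linarith [two_mul_le_rpow_three_halves_add (norm_nonneg z)]
  calc ‖quadExp z‖ ≤ 2 * Real.exp (2 * ‖z‖) := h1
    _ ≤ 2 * (Real.exp 8 * Real.exp (‖z‖ ^ (3 / 2 : ℝ))) := by gcongr
    _ = 2 * Real.exp 8 * Real.exp (‖z‖ ^ (3 / 2 : ℝ)) := by ring

/-- `quadExp` satisfies Farmer's standing hypotheses (order `< 2`, real on `ℝ`, zeros `± i` in the
strip `|Im z| ≤ 1`). [cite: Farmer2022, §2] -/
theorem isRealEntireOrderLtTwoStrip_quadExp : IsRealEntireOrderLtTwoStrip quadExp := by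
  refine ⟨isEntireOfOrderLt_two_quadExp, im_quadExp_ofReal, ⟨1, ?_⟩⟩
  intro z hz
  rcases (quadExp_eq_zero_iff z).1 hz with rfl | rfl <;> simp

/-! ## The factorisation `J^{d+2,n} = (X + 1)^d · Q_{d+2,n}` -/

/-- The quadratic factor `Q_{D,n} = α(n+D) X² + (2α(n) + 2nD) X + α(n)` (`D` the total degree). [folklore] -/
def quadFactor (D n : ℕ) : ℝ[X] :=
  C (quadExpCoeff (n + D)) * X ^ 2 + C (2 * quadExpCoeff n + 2 * n * D) * X + C (quadExpCoeff n)

/-- `J^{2,n}_α = Q_{2,n}`. [folklore] -/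
theorem jensenPoly_quadExpCoeff_two (n : ℕ) :
    Literature.NumberTheory.LFunctions.jensenPoly quadExpCoeff 2 n = quadFactor 2 n := by
  apply Polynomial.funext
  intro x
  simp only [Literature.NumberTheory.LFunctions.jensenPoly, quadFactor, quadExpCoeff, Finset.sum_range_succ, Finset.sum_range_zero,
    eval_mul, eval_C, eval_pow, eval_X, eval_add]
  norm_num [Nat.choose]
  ring

/-- The cubic identity behind the induction: `Q_{D,n} + X Q_{D,n+1} = (X + 1) Q_{D+1,n}`. [folklore] -/
theorem quadFactor_step (D n : ℕ) :
    quadFactor D n + X * quadFactor D (n + 1) = (X + 1) * quadFactor (D + 1) n := by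
  apply Polynomial.funext
  intro x
  simp only [quadFactor, quadExpCoeff, eval_add, eval_mul, eval_C, eval_pow, eval_X, eval_one]
  push_cast
  ring

/-- **Factorisation.** `J^{d+2,n}_α = (X + 1)^d · Q_{d+2,n}` for the witness sequence
`α = quadExpCoeff`. [folklore] -/
theorem jensenPoly_quadExpCoeff_eq (d n : ℕ) :
    Literature.NumberTheory.LFunctions.jensenPoly quadExpCoeff (d + 2) n = (X + 1) ^ d * quadFactor (d + 2) n := by
  induction d generalizing n with
  | zero => simpa using jensenPoly_quadExpCoeff_two n
  | succ d ih =>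
    rw [show d + 1 + 2 = (d + 2) + 1 by ring, jensenPoly_succ, ih, ih, pow_succ, mul_assoc,
      ← quadFactor_step]
    ring

/-- `Q_{D,n}` has degree `2`. [folklore] -/
theorem natDegree_quadFactor (D n : ℕ) : (quadFactor D n).natDegree = 2 := by
  rw [quadFactor]
  exact natDegree_quadratic (quadExpCoeff_pos _).ne'

/-- `Q_{D,n} ≠ 0`. [folklore] -/
theorem quadFactor_ne_zero (D n : ℕ) : quadFactor D n ≠ 0 := by
  intro h
  have := natDegree_quadFactor D n
  rw [h, natDegree_zero] at this
  exact absurd this (by norm_num)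

/-- Evaluation of `Q_{D,n}` at a real point. [folklore] -/
theorem eval_quadFactor (D n : ℕ) (x : ℝ) :
    (quadFactor D n).eval x =
      quadExpCoeff (n + D) * (x * x) + (2 * quadExpCoeff n + 2 * n * D) * x + quadExpCoeff n := by
  simp [quadFactor, pow_two]

/-- The discriminant of `Q_{D,n}`: `4 D ((n − 1)(n + D) + 1)`. [folklore] -/
theorem discrim_quadFactor (D n : ℕ) :
    discrim (quadExpCoeff (n + D)) (2 * quadExpCoeff n + 2 * n * D) (quadExpCoeff n) =
      4 * D * (((n : ℝ) - 1) * ((n : ℝ) + D) + 1) := by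
  rw [discrim]
  simp only [quadExpCoeff]
  push_cast
  ring

/-- For `n ≥ 1`, `Q_{D,n}` splits over `ℝ` (non-negative discriminant). [folklore] -/
theorem splits_quadFactor {n : ℕ} (hn : 1 ≤ n) (D : ℕ) : (quadFactor D n).Splits := by
  have hdisc : 0 ≤ discrim (quadExpCoeff (n + D)) (2 * quadExpCoeff n + 2 * n * D) (quadExpCoeff n) := by
    rw [discrim_quadFactor]
    have h1 : (1 : ℝ) ≤ n := by exact_mod_cast hn
    have hD : (0 : ℝ) ≤ D := by positivity
    have : 0 ≤ ((n : ℝ) - 1) * ((n : ℝ) + D) := mul_nonneg (by linarith) (by linarith)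
    positivity
  obtain ⟨x, hx⟩ := exists_quadratic_eq_zero (quadExpCoeff_pos (n + D)).ne'
    ⟨Real.sqrt _, (Real.mul_self_sqrt hdisc).symm⟩
  exact Splits.of_natDegree_eq_two (natDegree_quadFactor D n) (x := x) (by rw [eval_quadFactor]; exact hx)

/-- For `n = 0` and `D ≥ 2`, `Q_{D,0} = α(D) X² + 2X + 1` has no real root. [folklore] -/
theorem eval_quadFactor_zero_ne_zero {D : ℕ} (hD : 2 ≤ D) (x : ℝ) : (quadFactor D 0).eval x ≠ 0 := by
  rw [eval_quadFactor]
  apply quadratic_ne_zero_of_discrim_ne_sq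
  intro s hs
  rw [discrim_quadFactor] at hs
  push_cast at hs
  have h2 : (2 : ℝ) ≤ D := by exact_mod_cast hD
  have h3 : (2 : ℝ) ≤ (D : ℝ) * ((D : ℝ) - 1) := by nlinarith
  nlinarith [sq_nonneg s]

/-! ## Hyperbolicity for every shift `n ≥ 1`, non-hyperbolicity at shift `0` -/

/-- **All classical Jensen polynomials of `quadExp` with shift `n ≥ 1` are hyperbolic** (every degree
`d`). [folklore] -/
theorem splits_jensenPoly_quadExpCoeff {n : ℕ} (hn : 1 ≤ n) (d : ℕ) :
    (Literature.NumberTheory.LFunctions.jensenPoly quadExpCoeff d n).Splits := by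
  rcases Nat.lt_or_ge d 2 with hd | hd
  · exact Splits.of_natDegree_le_one ((natDegree_jensenPoly_le _ _ _).trans (by omega))
  · obtain ⟨d, rfl⟩ := Nat.exists_eq_add_of_le' hd
    rw [jensenPoly_quadExpCoeff_eq]
    exact ((Splits.X_add_C 1).pow d).mul (splits_quadFactor hn _)

/-- **No classical Jensen polynomial of `quadExp` with shift `0` and degree `d ≥ 2` is hyperbolic.**
[folklore] -/
theorem not_splits_jensenPoly_quadExpCoeff_zero {d : ℕ} (hd : 2 ≤ d) :
    ¬ (Literature.NumberTheory.LFunctions.jensenPoly quadExpCoeff d 0).Splits := by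
  obtain ⟨d, rfl⟩ := Nat.exists_eq_add_of_le' hd
  rw [jensenPoly_quadExpCoeff_eq]
  intro hsplit
  have hne : (X + 1 : ℝ[X]) ^ d * quadFactor (d + 2) 0 ≠ 0 :=
    mul_ne_zero (pow_ne_zero _ (X_add_C_ne_zero 1)) (quadFactor_ne_zero _ _)
  have hQ : (quadFactor (d + 2) 0).Splits := Splits.of_dvd hsplit hne (dvd_mul_left _ _)
  have hdeg : (quadFactor (d + 2) 0).degree ≠ 0 := by
    rw [degree_eq_natDegree (quadFactor_ne_zero _ _), natDegree_quadFactor]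
    norm_num
  obtain ⟨x, hx⟩ := hQ.exists_eval_eq_zero hdeg
  exact eval_quadFactor_zero_ne_zero (by omega) x hx

/-- In particular the witness sequence is `EventuallyHyperbolic` (with `N(d) = 1` for every `d`) but
not `AllHyperbolic`. [folklore] -/
theorem eventuallyHyperbolic_quadExpCoeff : EventuallyHyperbolic quadExpCoeff :=
  fun d _ ↦ ⟨1, fun _ hn ↦ splits_jensenPoly_quadExpCoeff hn d⟩

/-- … but not `AllHyperbolic`: `J^{2,0}_α = 3X² + 2X + 1` has non-real zeros. [folklore] -/
theorem not_allHyperbolic_quadExpCoeff : ¬ AllHyperbolic quadExpCoeff :=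
  fun h ↦ not_splits_jensenPoly_quadExpCoeff_zero le_rfl (h 2 0)

/-! ## The barrier -/

/-- **Barrier `JensenPolynomials` (Farmer 2022: large-`n` hyperbolicity of Jensen polynomials is a
general phenomenon and carries no information about the reality of zeros).** There is a function `f`
satisfying Farmer's standing hypotheses — entire of order `< 2`, real on `ℝ`, all zeros in a strip —
which has a non-real zero (the analogue of RH fails for `f`), and yet: its classical Jensen polynomials
`J^{d,n}_{f,cl}` are hyperbolic for EVERY degree `d` and EVERY shift `n ≥ 1` (the conclusion of Kim's
corollary `Farmer2022_kimCorollary` and the shape of GORZ Thm. 1 / `EventuallyHyperbolic`, uniformly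
with `N(d) = 1`), while `J^{d,0}_{f,cl}` fails to be hyperbolic for every `d ≥ 2`. Proved below
(`JensenPolynomials_holds`) with the witness `quadExp z = (1 + z²)eᶻ`; Farmer's printed witness is
`X_{10}` ("all zeros of the first derivative `X'_{10}` are real, therefore … `J^{d,n}_{X_{10},cl}` has
only real zeros for all `n ≥ 1`", §4).

BARRIER (structured block, D-0021):
- technique_class: Jensen-polynomial hyperbolicity for large shift `n` (GORZ-type theorems `EventuallyHyperbolic`, Hermite universality — GORZ Thm. 3 `GORZ2019_thm3_corollary` and, in the form GORZ actually establish for `γ`, the log-ratio expansion §5.1 (15)/Thm. 6 for every degree (`HasGORZExpansion`, `Literature.NumberTheory.LFunctions.jensenPoly_eventually_splits'`; covered by the sharpened entry `JensenPolynomialsNarrow` of `JensenPolynomialsProofs.lean`), Kim's repeated-differentiation theorem `Farmer2022_kimTheorem`), Turán-inequality/higher-Turán hierarchies in the shift aspect, and Jensen-like polynomial families à la O'Sullivan [cite: Farmer2022, §2 and §4]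
- blocks: RiemannHypothesis via Pólya's criterion `Literature.NumberTheory.LFunctions.polya_jensen` (`RH ↔ AllHyperbolic xiTaylorCoeff`) reached from large-shift information: `EventuallyHyperbolic a` does not imply `AllHyperbolic a` even for Taylor sequences of functions in the Kim–Farmer class with non-real zeros (this theorem), and `EventuallyHyperbolic xiTaylorCoeff` is the named fact `Literature.NumberTheory.LFunctions.gorz_eventually` (GORZ Thm. 1) [cite: GORZPNAS2019, Thm. 1] [cite: Farmer2022, §2 and §4]
- because: "the classical Jensen polynomials `J^{d,n}_{f,cl}` having real zeros for large `n` is a general phenomenon, following from the fact that, for a large class of entire functions, repeated differentiation leads to the cosine function … differentiation causes a loss of information about the zeros" [cite: Farmer2022, §2]; Kim: for `f` real entire of order `< 2` with zeros in a strip, `f^{(n)}` has only real zeros in `|z| < R` for `n` large, whence `J^{d,n}_{f,cl}` is hyperbolic for `n` large, whether or not `f` has non-real zeros [cite: Farmer2022, §2] [cite: Kim1996]; GORZ Thm. 1 is an instance of a universality statement (Thm. 3) valid for any sequence with suitable growth [cite: GORZPNAS2019, Thm. 3 and Corollary]; at shift `0`, hyperbolicity of `J^{d,0}_γ` for `d <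 T²` follows from RH up to height `T` (Chasse), so the Jensen polynomials "are not efficient at extracting information from those coefficients" [cite: Farmer2022, §4] [cite: Chasse2013, Thm. 1.8]
- evasions_known: none published: O'Sullivan's Hermite-twisted polynomials `P^{d,n}` satisfy `J^{d,n}_{Ξ,ev}` hyperbolic ⟹ `P^{d,n}` hyperbolic, so they are "less useful at detecting violations of the Riemann Hypothesis" [cite: Farmer2022, §4 ('Other Jensen-like polynomials')]; hyperbolicity for ALL shifts is known only for `d ≤ 8` (`Literature.NumberTheory.LFunctions.gorz_le_eight`) [cite: GORZPNAS2019, Thm. 2]; later large-shift theorems all land inside `EventuallyHyperbolic` and are covered — Griffin–Ono–Rolen–Thorner–Tripp–Wagner (`J^{d,n}_γ` hyperbolic for `n ≥ c e^{d/2}`), O'Sullivan Thm. 1.3 (`P^{d,n}` for `n/log² n ≥ d^{3/4}/2`), Holland 2026 Thm. 1.1 (the wedge `n³ log²(n+2) ≥ K d⁵`, with the author's own disclaimer, §12: "does not provide a converse route from partial Jensen hyperbolicity to the Riemann hypothesis; see Farmer"); Durán 2024 gives new RH *equivalences* (real-rootedness of Brenke polynomial families for all `n`) and another proof of GORZ Thm.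 1, not a route from partial data (audit 2026-08-16) [cite: GriffinEtAl2022, Thm. 1.1] [cite: Osullivan2021, Thm. 1.3] [cite: Holland2026, Thm. 1.1 and §12] [cite: Duran2024, Cor. 1.3 and §7]
- status: established (the witness statement is proved here; Kim's theorem, GORZ Thms. 1–3 and Chasse's bound are published theorems; that the route is "not viable" is Farmer's stated assessment [cite: Farmer2022, §1])
- scope_caveats: the theorem closes inferences from large-shift (`n → ∞`, each fixed `d`) hyperbolicity; it says nothing against proving `AllHyperbolic xiTaylorCoeff` — equivalently hyperbolicity of `J^{d,0}_γ` for every `d`, which IS RH by Pólya — by other means; Farmer's shift-`0` point (inefficiency, `d < T²`) is quantitative, not a no-go theorem [cite: Farmer2022, §4]; Farmer's own witness `X_{10}` rests on reading the zeros of `X'_{10}` off a graph, the witness proved here is `(1 + z²)eᶻ`; AUDIT 2026-08-16: (i) the witness `quadExp` lies in the Kim–Farmer class but NOT in the Hermite-universality sub-family of the technique class — its `J^{d+2,n} = (X+1)^d Q_{d+2,n}` have a `d`-fold root, the GORZ-rescaled root set at `d = 3` tends to `{−2, 1 ± √3}` rather than to the roots `{0, ±√6}` of `H₃`, and `J^{2,0}`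 already violates Turán's inequality — so THIS theorem covers the Kim sub-family; the universality sub-family (which contains `γ`: `hasGORZExpansion_xiTaylorCoeff`) is covered by `JensenPolynomialsNarrow`/`JensenPolynomialsNarrow_holds` in `JensenPolynomialsProofs.lean` (`γ` with one coefficient changed: (15) for every `d`, `EventuallyHyperbolic`, all `J^{d,0}_γ` with `d ≤ k` unchanged, Turán fails at shift `k`); (ii) the literal hypothesis (4) of GORZ Thm. 3 forces `Δ³ log α = o(δ^d)` (`isLittleO_thirdDiff_of_gorzThm3`) and fails for `γ` for every `d ≥ 4` (`δ² ∼ 1/(2n)`, `Δ³ log γ ∼ 1/n²`; paper computation) — the operative peg is (15); (iii) NOT covered by either witness: shift-UNIFORM hyperbolicity at bounded degree (`J^{d,n}_γ` for all `n`: `d ≤ 3` Csordas–Norfolk–Varga/Dimitrov–Lucas, `d ≤ 8` GORZ Thm. 2, `d ≤ 64` the tree's `Literature.NumberTheory.LFunctions.jensenPoly_xiTaylorCoeff_splits_of_le`, `4d ≤ T²` from RH to height `T`, Kim–Lee Thm. 4 / Chasse), whose extension to all `d` is RH itself; Farmer's `X_{10}` suggests such data do not help either — and this is now PROVED for every fixed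 degree bound `D`: `JensenPolynomialsShiftUniform`/`JensenPolynomialsShiftUniform_holds` in `JensenPolynomialsCone.lean` (an explicit genus-zero witness `((w+1)² + 1/D)·G`, `G(z²) = cosh z`: (15) for every degree, `EventuallyHyperbolic`, `J^{d,n}` hyperbolic for ALL `n` and all `d ≤ D`, yet not `AllHyperbolic`); what remains outside all three witnesses is only degree-UNIFORM information at a fixed shift and the arithmetic of the actual values `γ(n)` [cite: Farmer2022, §4] [cite: KimLee2021, Thm. 4 and Remark]

[cite: Farmer2022, §2 and §4] -/
def JensenPolynomials : Prop :=
  ∃ f : ℂ → ℂ, IsRealEntireOrderLtTwoStrip f ∧ (∃ z : ℂ, f z = 0 ∧ z.im ≠ 0) ∧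
    (∀ j : ℕ, (iteratedDeriv j f 0).im = 0) ∧
    (∀ d n : ℕ, 1 ≤ n → (classicalJensenPoly f d n).Splits) ∧
    (∀ d : ℕ, 2 ≤ d → ¬ (classicalJensenPoly f d 0).Splits)

/-- **The barrier holds**, witnessed by `quadExp z = (1 + z²) eᶻ`. [cite: Farmer2022, §4] -/
theorem JensenPolynomials_holds : JensenPolynomials := by
  refine ⟨quadExp, isRealEntireOrderLtTwoStrip_quadExp, ⟨I, by simp [quadExp_eq_zero_iff], by simp⟩,
    im_iteratedDeriv_quadExp_zero, ?_, ?_⟩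
  · intro d n hn
    rw [classicalJensenPoly, taylorCoeffSeq_quadExp]
    exact splits_jensenPoly_quadExpCoeff hn d
  · intro d hd
    rw [classicalJensenPoly, taylorCoeffSeq_quadExp]
    exact not_splits_jensenPoly_quadExpCoeff_zero hd

/-- Corollary: large-shift hyperbolicity does not imply full hyperbolicity, even for Taylor sequences
of functions in the Kim–Farmer class — so `EventuallyHyperbolic xiTaylorCoeff` (GORZ Thm. 1) cannot by
itself yield `AllHyperbolic xiTaylorCoeff` (= RH). [cite: Farmer2022, §2] -/
theorem not_allHyperbolic_of_eventuallyHyperbolic :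
    ¬ ∀ f : ℂ → ℂ, IsRealEntireOrderLtTwoStrip f →
        EventuallyHyperbolic (taylorCoeffSeq f) → AllHyperbolic (taylorCoeffSeq f) := by
  intro h
  have := h quadExp isRealEntireOrderLtTwoStrip_quadExp
  rw [taylorCoeffSeq_quadExp] at this
  exact not_allHyperbolic_quadExpCoeff (this eventuallyHyperbolic_quadExpCoeff)

/-- Corollary: Kim's corollary (as printed) is consistent with non-real zeros — its conclusion holds
for `quadExp`, which violates "RH"; so `Farmer2022_kimCorollary` applied to `Ξ`-type functions proves
nothing about the reality of their zeros. [cite: Farmer2022, §2] -/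
theorem kimCorollary_conclusion_quadExp :
    (∀ d : ℕ, ∃ N : ℕ, ∀ n : ℕ, N ≤ n → (classicalJensenPoly quadExp d n).Splits) ∧
      ∃ z : ℂ, quadExp z = 0 ∧ z.im ≠ 0 := by
  refine ⟨fun d ↦ ⟨1, fun n hn ↦ ?_⟩, ⟨I, by simp [quadExp_eq_zero_iff], by simp⟩⟩
  rw [classicalJensenPoly, taylorCoeffSeq_quadExp]
  exact splits_jensenPoly_quadExpCoeff hn d

end Literature.Barriers.RiemannHypothesis
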